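import Literature.AlgebraicGeometry.HodgeTheory.SpreadSupportsSpreadSet
import Literature.AlgebraicGeometry.HodgeTheory.SpreadSupportsOverCurve
import Literature.AlgebraicGeometry.HodgeTheory.MotivatedClassesDeformation
import Literature.AlgebraicGeometry.HodgeTheory.IsoTransport
import Literature.AlgebraicGeometry.HodgeTheory.QuasiProjectiveOfAffine
import Literature.AlgebraicGeometry.Motives.ComplexPointsEhresmann
import Literature.AlgebraicGeometry.Motives.CyclesBirationalLiftProofs
import Literature.AlgebraicGeometry.Motives.BlowupTwoGeneratorsResidueField
import Literature.AlgebraicGeometry.HodgeTheory.SpreadAlgebraicClassesPencil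
import Literature.AlgebraicGeometry.Motives.VarietiesProjectiveSpaceProofs
import Literature.AlgebraicGeometry.Motives.VarietiesProperProofs
import HarnessLib

/-!
# Spreading supports over a curve, III: the named fact from Verdier's generic local triviality

Topic `Literature/AlgebraicGeometry/HodgeTheory` (family `hodge`). Proof file (D-0014 discharge,
modulo one published input) of the named fact `spread_supports_over_smoothCurve`
(`SpreadSupportsOverCurve.lean`; Voisin, *Hodge Theory II*, §3.3.1 and proof of Thm. 10.19;
Charles–Schnell, proof of Prop. 11.3.11):
`spread_supports_over_smoothCurve_of_verdier : Motives.Verdier1976_genericLocalTriviality → spread_supports_over_smoothCurve`,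
where the hypothesis is the NAMED FACT recording Verdier's generic topological local triviality of
a proper morphism compatibly with finitely many closed subsets (Verdier 1976, Thm. (2.2) + (3.3) +
(4.14), Cor. (5.1); `Motives/VerdierGenericLocalTriviality`, verbatim the inline hypothesis of
`AlgebraicityLocusFromFacts`) — the same single input on which the tree's proof of
`charlesSchnell_algebraicityLocus_iUnion_closed` rests; Mumford's curve lemma enters proved.

* `exists_spread_data_of_verdier` — **restriction to a good affine open of an arbitrary base
  curve**: the machinery of parts I–II works over a smooth integral QUASI-PROJECTIVE curve all of
  whose fibres are good, while the named fact has an arbitrary smooth irreducible base `T` (not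
  necessarily separated or quasi-compact) with bad fibres over a proper closed `S ⊊ T`. Choose an
  affine open `U₁ ⊆ T ∖ S` (quasi-projective: `IsQuasiProjectiveOver.of_isAffine`), base-change the
  family to it (`familyPullback`: proper, quasi-projective total space, the same fibres up to
  isomorphism, `fiberOverFamilyPullbackIso`; algebraicity transports along isomorphisms,
  `mem_algebraicClasses_map_iff_of_iso`), apply `exists_isClosed_spread_of_verdier`, and transport
  the spread set back into `W` along the open immersion `W ×_T U₁ → W`: a non-empty open
  `U ⊆ T ∖ S` and a Zariski-closed `Zc ⊆ W` whose slices over the complex points of `U` have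
  dimension `≤ d - q` pointwise and carry the classes `c|_{W_t}` (restriction to complements
  commutes with pull-back, `complexBetti.restrictCompl_map_eq_zero`; open immersions preserve
  dimensions of closures of points, `height_base_eq_of_isOpenImmersion_of_schemeOver`).
* `spread_supports_over_smoothCurve_of_verdier` — **the named fact**: put `𝒵 := closure (Zc ∩ f⁻¹U)`
  and `S' := T ∖ U`. Dying-off over `U` is inherited (slices only grow). The dimension bound on ALL
  slices of `𝒵` ("the limit of a family of `(d-q)`-dimensional supports over a curve is
  `(d-q)`-dimensional", Fulton §10.1) is the curve argument of
  `AlgebraicityLocusCurves.exists_height_le_of_sliceAt_mem_closure`, run inside `P × T ⊇ W` for a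
  projective `P ⊇ W` — the graph morphism `(j, f) : W ⟶ P × T` is proper (hence closed) and
  preserves dimensions of closures of points (`isProper_lift_and_height_eq`): `Zc ∩ f⁻¹U` is a
  Noetherian space (`W` is quasi-projective), so `𝒵` is the finite union of the closures of the
  generic points `ζ ∈ Zc ∩ f⁻¹U` of its irreducible pieces; a slice point `x ∈ W_t` in
  `closure {ζ}` either lies in the good slice over `f(ζ) = t` (when `f(ζ)` is a closed point), or —
  when `ζ` lies over the generic point of `T` — in the fibre over `t` of the integral closed
  subscheme `closure {(j, f)(ζ)}` of `P × T`, which dominates the smooth curve `T`, hence is flat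
  over it with fibres of constant dimension (`height_familyFiber_le_of_isMax`), attained over a
  complex point of `U` inside a good slice. The strong form `exists_spread_supports_of_verdier`
  (no flatness needed; with the total-space bound `height z + q ≤ d + 1` on `𝒵`) is proved first,
  as `exists_spread_supports_of_spread_data` (the closure argument from ANY spread data `U`, `Zc`
  over a good open — so that other generic-triviality inputs can feed it) applied to the output of
  `exists_spread_data_of_verdier`.
* `spread_supports_over_projectiveLine_of_verdier` — **the pencil fact (I) of
  `SpreadAlgebraicClassesPencil`** from the strong form with `T = ℙ¹`, `W = X` smooth projective:
  the total-space bound `height z + q ≤ n` is the codimension bound `q ≤ coheight z` on `X`.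

## References

* [VoisinHodgeII2003] C. Voisin, Hodge Theory and Complex Algebraic Geometry II (2003), §3.3.1;
  §10.2.1, proof of Thm. 10.19.
* [CharlesSchnell2014Notes] F. Charles, C. Schnell, Notes on absolute Hodge classes (2014),
  Prop. 11.3.11 (proof).
* [Fulton1998] W. Fulton, Intersection Theory (1998), §10.1.
* [Hartshorne1977] R. Hartshorne, Algebraic Geometry (1977), III Prop. 9.7.
* [GortzWedhorn2020] U. Görtz, T. Wedhorn, Algebraic Geometry I, 2nd ed. (2020), Thm. 5.22.
* [Verdier1976] J.-L. Verdier, Stratifications de Whitney et théorème de Bertini–Sard, Invent.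
  Math. 36 (1976), Thm. (3.3), Thm. (4.14), Cor. (5.1).
-/

noncomputable section

open CategoryTheory AlgebraicGeometry Limits Set Order MonoidalCategory CartesianMonoidalCategory
open _root_.Topology TopologicalSpace Filter
open Literature.AlgebraicGeometry.Motives Literature.AlgebraicTopology.SingularHomology

namespace Literature.AlgebraicGeometry.HodgeTheory

section HodgeTheory

section Restriction

/-! (Support bookkeeping used below — restriction to complements commutes with pull-back:
`complexBetti.restrictCompl_map_eq_zero`, `GysinFormalismCorrespondences`; dying off a set is
monotone in the set: `complexBetti.restrictCompl_eq_zero_of_subset`, `GysinFormalismPushforward`.) -/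

/-! ### Open immersions preserve dimensions of closures of points -/

/-- For an open immersion `g : V ⟶ W` of `ℂ`-schemes locally of finite type over `ℂ`,
`height (g v) = height v` (the residue fields agree; Görtz–Wedhorn I, Thm. 5.22 (1) and (3)).
[cite: GortzWedhorn2020, Thm. 5.22] -/
theorem height_base_eq_of_isOpenImmersion_of_schemeOver {V W : Motives.SchemeOver ℂ}
    [LocallyOfFiniteType V.hom] [LocallyOfFiniteType W.hom] (g : V ⟶ W) [IsOpenImmersion g.left]
    (v : V.left) : height (g.left.base v) = height v := by
  haveI : LocallyOfFiniteType (g.left ≫ W.hom) := by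
    rw [Over.w g]
    infer_instance
  exact (height_eq_height_of_residueFieldMap_surjective g.left W.hom v
    (residueFieldMap_surjective_of_stalkMap_surjective g.left v (g.left.stalkMap_surjective v))).symm

/-! ### Spread data over a good affine open of the base -/

/-- **Spread data over a good open of an arbitrary smooth irreducible base curve.** Let `T` be a
smooth integral curve over `ℂ` (any `ℂ`-scheme smooth of relative dimension `1` with integral
underlying space), `W` quasi-projective over `ℂ`, `f : W ⟶ T` proper, `S ⊊ T` Zariski-closed such
that the fibres over the complex points off `S` are smooth projective `d`-folds, and
`c ∈ H^{2q}(W(ℂ); ℂ)` algebraic on every such fibre. Granted Verdier's generic local triviality of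
pairs (`hGT`), there are a non-empty open `U ⊆ T ∖ S` and a Zariski-closed `Zc ⊆ W` such that for
every complex point `t` of `U`, every point `m` of `W_t` with `ι_t m ∈ Zc` has `height m + q ≤ d`,
and `c|_{W_t}` dies off `ι_t⁻¹ Zc`. Proof: restrict to an affine open `U₁ ⊆ T ∖ S`
(quasi-projective: `IsQuasiProjectiveOver.of_isAffine`); the base change `W ×_T U₁ → U₁` is proper
with the same fibres (`fiberOverFamilyPullbackIso`), smooth projective and carrying algebraic
restrictions of `c` (`mem_algebraicClasses_map_iff_of_iso`); `exists_isClosed_spread_of_verdier`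
gives `O₀ ⊆ U₁` and `Z₁ ⊆ W ×_T U₁`; set `U := O₀` (as an open of `T`) and `Zc :=` the closure in
`W` of the image of `Z₁` under the open immersion `W ×_T U₁ → W`, whose trace on `f⁻¹U₁` is that
image; heights transport along open immersions and fibre inclusions, vanishing along the fibre
isomorphisms (`complexBetti.restrictCompl_map_eq_zero`).
[cite: VoisinHodgeII2003, §3.3.1 and §10.2.1 (proof of Thm. 10.19)]
[cite: CharlesSchnell2014Notes, Prop. 11.3.11 (proof)] -/
theorem exists_spread_data_of_verdier
    (hGT : Verdier1976_genericLocalTriviality)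
    {d q : ℕ} {T W : Motives.SchemeOver ℂ} (f : W ⟶ T) [IsIntegral T.left]
    [SmoothOfRelativeDimension 1 T.hom] (hW : IsQuasiProjectiveOver W) [IsProper f.left]
    {S : Set T.left} (hS : IsClosed S) (hSne : S ≠ Set.univ)
    (hfib : ∀ t : Motives.ComplexPoints T, t.pt ∉ S →
      Motives.IsSmoothProjective d (Motives.fiberOver f t))
    (c : complexBetti W (2 * q))
    (halg : ∀ t : Motives.ComplexPoints T, t.pt ∉ S →
      complexBetti.map (Motives.fiberι f t) (2 * q) c ∈ algebraicClasses (Motives.fiberOver f t) q) :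
    ∃ U : T.left.Opens, (U : Set T.left).Nonempty ∧ (U : Set T.left) ⊆ Sᶜ ∧
      ∃ Zc : Set W.left, IsClosed Zc ∧
        ∀ t : Motives.ComplexPoints T, t.pt ∈ U →
          (∀ m : (Motives.fiberOver f t).left, (Motives.fiberι f t).left.base m ∈ Zc →
            height m + q ≤ (d : ℕ∞)) ∧
          complexBetti.restrictCompl (Motives.fiberOver f t) ((Motives.fiberι f t).left.base ⁻¹' Zc)
            (2 * q) (complexBetti.map (Motives.fiberι f t) (2 * q) c) = 0 := by
  -- the standing instances on `T` and `W`
  haveI : Smooth T.hom := SmoothOfRelativeDimension.smooth 1 T.hom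
  haveI : LocallyOfFiniteType T.hom := inferInstance
  haveI : LocallyOfFiniteType W.hom := locallyOfFiniteType_of_isQuasiProjectiveOver hW
  -- an affine open `U₁ ⊆ T ∖ S`
  obtain ⟨x₀, hx₀⟩ : (Sᶜ : Set T.left).Nonempty := Set.nonempty_compl.2 hSne
  obtain ⟨U₁, hU₁aff, hx₀U₁, hU₁S⟩ := (TopologicalSpace.Opens.isBasis_iff_nbhd.mp
    T.left.isBasis_affineOpens) (show x₀ ∈ (⟨Sᶜ, hS.isOpen_compl⟩ : T.left.Opens) from hx₀)
  -- the open subscheme `T₁ = U₁` of `T`: a smooth integral affine curve, quasi-projective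
  set T₁ : Motives.SchemeOver ℂ := openSubschemeOver T U₁ with hT₁
  set ι₁ : T₁ ⟶ T := openSubschemeOverι T U₁ with hι₁
  haveI : IsAffine T₁.left := hU₁aff
  haveI : IsOpenImmersion ι₁.left := inferInstanceAs (IsOpenImmersion (Scheme.Opens.ι U₁))
  have hι₁range : Set.range ι₁.left.base = (U₁ : Set T.left) := Scheme.Opens.range_ι U₁
  haveI : Nonempty T₁.left := ⟨(⟨x₀, hx₀U₁⟩ : U₁)⟩
  haveI : IrreducibleSpace T₁.left := by
    haveI : Nonempty U₁ := ⟨⟨x₀, hx₀U₁⟩⟩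
    exact isIrreducible_iff_irreducibleSpace.mp
      ⟨⟨x₀, hx₀U₁⟩, (PreirreducibleSpace.isPreirreducible_univ (X := T.left)).open_subset U₁.isOpen
        (Set.subset_univ _)⟩
  haveI hT₁sm : SmoothOfRelativeDimension 1 T₁.hom := by
    have h : SmoothOfRelativeDimension (0 + 1) (Scheme.Opens.ι U₁ ≫ T.hom) := inferInstance
    rwa [Nat.zero_add] at h
  haveI : Smooth T₁.hom := SmoothOfRelativeDimension.smooth 1 T₁.hom
  haveI : IsReduced T₁.left := isReduced_of_smooth_over_field T₁.hom
  haveI : IsIntegral T₁.left := isIntegral_of_irreducibleSpace_of_isReduced T₁.left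
  haveI : LocallyOfFiniteType T₁.hom := inferInstance
  have hT₁q : IsQuasiProjectiveOver T₁ := IsQuasiProjectiveOver.of_isAffine T₁
  -- the base-changed family `f₁ : 𝒳₁ = W ×_T T₁ ⟶ T₁` and the open immersion `g₁ : 𝒳₁ ⟶ W`
  set 𝒳₁ : Motives.SchemeOver ℂ := familyPullback f ι₁ with h𝒳₁def
  set f₁ : 𝒳₁ ⟶ T₁ := familyPullback.snd f ι₁ with hf₁
  set g₁ : 𝒳₁ ⟶ W := familyPullback.fst f ι₁ with hg₁
  haveI : IsProper f₁.left := by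
    change IsProper (pullback.snd f.left ι₁.left)
    infer_instance
  haveI : IsOpenImmersion g₁.left := by
    change IsOpenImmersion (pullback.fst f.left ι₁.left)
    infer_instance
  have hg₁range : Set.range g₁.left.base = f.left.base ⁻¹' (U₁ : Set T.left) := by
    change Set.range (pullback.fst f.left ι₁.left).base = _
    rw [Scheme.Pullback.range_fst, hι₁range]
  have h𝒳₁ : IsQuasiProjectiveOver 𝒳₁ := by
    obtain ⟨P, jW, hP, hjW⟩ := hW
    haveI := hjW
    refine ⟨P, g₁ ≫ jW, hP, ?_⟩
    rw [Over.comp_left]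
    infer_instance
  haveI : LocallyOfFiniteType 𝒳₁.hom := locallyOfFiniteType_of_isQuasiProjectiveOver h𝒳₁
  have hcond : g₁ ≫ f = f₁ ≫ ι₁ := familyPullback.condition f ι₁
  -- complex points of `T₁` are complex points of `T` in `U₁`, hence off `S`
  have hι₁pt : ∀ u : Motives.ComplexPoints T₁, (AlgPoints.map ι₁ u).pt ∈ (U₁ : Set T.left) :=
    fun u => by rw [AlgPoints.pt_map, ← hι₁range]; exact ⟨u.pt, rfl⟩
  have hι₁S : ∀ u : Motives.ComplexPoints T₁, (AlgPoints.map ι₁ u).pt ∉ S :=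
    fun u h => hU₁S (hι₁pt u) h
  -- the fibres of `f₁` are the fibres of `f` off `S`: smooth projective, carrying algebraic classes
  set A : complexBetti 𝒳₁ (2 * q) := complexBetti.map g₁ (2 * q) c with hA
  have hAfib : ∀ u : Motives.ComplexPoints T₁,
      complexBetti.map (Motives.fiberι f₁ u) (2 * q) A =
        complexBetti.map (fiberOverFamilyPullbackIso f ι₁ u).hom (2 * q)
          (complexBetti.map (Motives.fiberι f (AlgPoints.map ι₁ u)) (2 * q) c) := fun u => by
    rw [hA, ← ModuleCat.comp_apply, ← complexBetti.map_comp, ← ModuleCat.comp_apply,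
      ← complexBetti.map_comp, fiberOverFamilyPullbackIso_hom_fiberι]
  have hfib₁ : ∀ u : Motives.ComplexPoints T₁, Motives.IsSmoothProjective d (Motives.fiberOver f₁ u) :=
    fun u => (hfib _ (hι₁S u)).of_iso (fiberOverFamilyPullbackIso f ι₁ u).symm
  have halg₁ : ∀ u : Motives.ComplexPoints T₁, complexBetti.map (Motives.fiberι f₁ u) (2 * q) A ∈
      algebraicClasses (Motives.fiberOver f₁ u) q := fun u => by
    rw [hAfib u]
    exact (mem_algebraicClasses_map_iff_of_iso (fiberOverFamilyPullbackIso f ι₁ u)).2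
      (halg _ (hι₁S u))
  -- the spread set over a non-empty open `O₀ ⊆ T₁`
  obtain ⟨O₀, hO₀ne, Z₁, hZ₁c, hZ₁⟩ :=
    exists_isClosed_spread_of_verdier hGT f₁ hT₁q h𝒳₁ q hfib₁ A halg₁
  -- transport to `T` and `W`
  set U : T.left.Opens := ⟨ι₁.left.base '' (O₀ : Set T₁.left),
    ι₁.left.isOpenEmbedding.isOpenMap _ O₀.2⟩ with hU
  set Zc : Set W.left := closure (g₁.left.base '' Z₁) with hZc
  have hZcU₁ : ∀ w : W.left, w ∈ Zc → f.left.base w ∈ (U₁ : Set T.left) →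
      ∃ z ∈ Z₁, g₁.left.base z = w := by
    intro w hw hwU₁
    obtain ⟨z, rfl⟩ : w ∈ Set.range g₁.left.base := by rw [hg₁range]; exact hwU₁
    refine ⟨z, ?_, rfl⟩
    have h1 : z ∈ closure Z₁ := by
      rw [g₁.left.isOpenEmbedding.isEmbedding.closure_eq_preimage_closure_image]
      exact hw
    rwa [hZ₁c.closure_eq] at h1
  refine ⟨U, ?_, ?_, Zc, isClosed_closure, fun t ht => ?_⟩
  · obtain ⟨o, ho⟩ := hO₀ne
    exact ⟨ι₁.left.base o, o, ho, rfl⟩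
  · rintro _ ⟨o, -, rfl⟩ hoS
    exact hU₁S (show ι₁.left.base o ∈ (U₁ : Set T.left) by rw [← hι₁range]; exact ⟨o, rfl⟩) hoS
  -- `t = ι₁ u` for a complex point `u` of `O₀`
  obtain ⟨o, ho, hot⟩ := ht
  obtain ⟨u, rfl⟩ : t ∈ Set.range (AlgPoints.map (L := ℂ) ι₁) := by
    rw [AlgPoints.range_map_of_isOpenImmersion_holds ι₁]
    exact ⟨o, hot⟩
  have huo : u.pt = o := ι₁.left.isOpenEmbedding.injective (by rw [← AlgPoints.pt_map]; exact hot.symm)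
  obtain ⟨hbound, hdies⟩ := hZ₁ u (huo ▸ ho)
  set e := fiberOverFamilyPullbackIso f ι₁ u with he
  have hefac : ∀ m₁ : (Motives.fiberOver f₁ u).left,
      (Motives.fiberι f (AlgPoints.map ι₁ u)).left.base (e.hom.left.base m₁) =
        g₁.left.base ((Motives.fiberι f₁ u).left.base m₁) := fun m₁ => by
    have h1 := congrArg (fun φ => φ.left.base m₁) (fiberOverFamilyPullbackIso_hom_fiberι f ι₁ u)
    simpa only [Over.comp_left, Scheme.Hom.comp_base, TopCat.coe_comp, Function.comp_apply] using h1
  refine ⟨fun m hm => ?_, ?_⟩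
  · -- heights: `ι_t m = g₁ (ι_u m₁)` with `ι_u m₁ ∈ Z₁`
    have hmU₁ : f.left.base ((Motives.fiberι f (AlgPoints.map ι₁ u)).left.base m) ∈
        (U₁ : Set T.left) := by
      rw [apply_fiberι_base_eq_pt]
      exact hι₁pt u
    obtain ⟨z, hz, hzm⟩ := hZcU₁ _ hm hmU₁
    have hzu : f₁.left.base z = u.pt := by
      apply ι₁.left.isOpenEmbedding.injective
      have h1 := congrArg (fun φ => φ.left.base z) hcond
      simp only [Over.comp_left, Scheme.Hom.comp_base, TopCat.coe_comp, Function.comp_apply] at h1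
      rw [← h1, hzm, apply_fiberι_base_eq_pt, AlgPoints.pt_map]
    obtain ⟨m₁, rfl⟩ := exists_fiberι_base_eq f₁ u z hzu
    have h1 := hbound m₁ hz
    have h2 : height m = height m₁ := by
      rw [← height_fiberι_base_eq f (AlgPoints.map ι₁ u) m, ← hzm,
        height_base_eq_of_isOpenImmersion_of_schemeOver g₁, height_fiberι_base_eq f₁ u m₁]
    rwa [h2]
  · -- dying off: transport along the fibre isomorphism `e`, then enlarge the set
    have hct : complexBetti.map (Motives.fiberι f (AlgPoints.map ι₁ u)) (2 * q) c =
        complexBetti.map e.inv (2 * q) (complexBetti.map (Motives.fiberι f₁ u) (2 * q) A) := by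
      rw [hAfib u, ← he, e.complexBetti_map_inv_map_hom]
    rw [hct]
    refine complexBetti.restrictCompl_eq_zero_of_subset ?_
      (complexBetti.restrictCompl_map_eq_zero e.inv hdies)
    intro m hm
    change (Motives.fiberι f₁ u).left.base (e.inv.left.base m) ∈ Z₁ at hm
    change (Motives.fiberι f (AlgPoints.map ι₁ u)).left.base m ∈ Zc
    have h1 : (Motives.fiberι f (AlgPoints.map ι₁ u)).left.base m =
        g₁.left.base ((Motives.fiberι f₁ u).left.base (e.inv.left.base m)) := by
      rw [← hefac]
      have h2 := congrArg (fun φ => φ.left.base m) e.inv_hom_id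
      simp only [Over.comp_left, Scheme.Hom.comp_base, TopCat.coe_comp, Function.comp_apply,
        Over.id_left, Scheme.Hom.id_base, TopCat.coe_id, id_eq] at h2
      rw [h2]
    rw [h1]
    exact subset_closure ⟨_, hm, rfl⟩

end Restriction

section Final

/-! ### The graph morphism of a proper morphism from a quasi-projective scheme -/

/-- For `j : W ⟶ P` an open immersion and `f : W ⟶ T` proper with `P` proper over `ℂ`, the graph
morphism `(j, f) : W ⟶ P × T` is proper (it is followed by the separated projection to `T` with
proper composite `f`) and preserves the dimensions of closures of points (its stalk maps are
surjective, being followed by those of the open immersion `j = (j, f) ≫ pr₁`, so its residue fields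
agree with those of `W`; Görtz–Wedhorn I, Thm. 5.22 (1)). [cite: GortzWedhorn2020, Thm. 5.22 (1)] -/
theorem isProper_lift_and_height_eq {W P T : Motives.SchemeOver ℂ} [LocallyOfFiniteType W.hom]
    [IsProper P.hom] [LocallyOfFiniteType T.hom] (j : W ⟶ P)
    [IsOpenImmersion j.left] (f : W ⟶ T) [IsProper f.left] :
    IsProper (CartesianMonoidalCategory.lift j f).left ∧
      ∀ x : W.left, height ((CartesianMonoidalCategory.lift j f).left.base x) = height x := by
  set e : W ⟶ P ⊗ T := CartesianMonoidalCategory.lift j f with he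
  haveI : IsSeparated (CartesianMonoidalCategory.snd P T).left :=
    inferInstanceAs (IsSeparated (pullback.snd P.hom T.hom))
  haveI : LocallyOfFiniteType (P ⊗ T).hom :=
    inferInstanceAs (LocallyOfFiniteType (pullback.fst P.hom T.hom ≫ P.hom))
  have hsnd : e.left ≫ (CartesianMonoidalCategory.snd P T).left = f.left :=
    congrArg CommaMorphism.left (CartesianMonoidalCategory.lift_snd j f)
  have hfst : e.left ≫ (CartesianMonoidalCategory.fst P T).left = j.left :=
    congrArg CommaMorphism.left (CartesianMonoidalCategory.lift_fst j f)
  haveI : IsProper (e.left ≫ (CartesianMonoidalCategory.snd P T).left) := by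
    rw [hsnd]
    infer_instance
  refine ⟨IsProper.of_comp e.left (CartesianMonoidalCategory.snd P T).left, fun x => ?_⟩
  haveI : LocallyOfFiniteType (e.left ≫ (P ⊗ T).hom) := by
    rw [Over.w e]
    infer_instance
  refine (height_eq_height_of_residueFieldMap_surjective e.left (P ⊗ T).hom x ?_).symm
  -- the stalk map of `e` at `x` is surjective: `pr₁ ∘ e = j` has bijective stalk maps
  apply residueFieldMap_surjective_of_stalkMap_surjective e.left x
  have hcomp : (e.left ≫ (CartesianMonoidalCategory.fst P T).left).stalkMap x =
      (CartesianMonoidalCategory.fst P T).left.stalkMap (e.left.base x) ≫ e.left.stalkMap x :=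
    Scheme.Hom.stalkMap_comp _ _ x
  have hsurj : Function.Surjective ((e.left ≫ (CartesianMonoidalCategory.fst P T).left).stalkMap x) := by
    rw [hfst]
    exact j.left.stalkMap_surjective x
  rw [hcomp] at hsurj
  exact Function.Surjective.of_comp hsurj

/-! ### The spread of supports, strong form: the closure argument, and the form from Verdier's generic local triviality -/

/-- On a smooth integral curve a point other than the generic point is closed. [folklore] -/
theorem isClosed_singleton_of_ne_top_of_smoothCurve {T : Motives.SchemeOver ℂ} [IsIntegral T.left]
    [SmoothOfRelativeDimension 1 T.hom] [LocallyOfFiniteType T.hom] {x : T.left} (hx : x ≠ ⊤) :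
    IsClosed ({x} : Set T.left) := by
  refine closure_subset_iff_isClosed.1 fun y hy => ?_
  exact Set.mem_singleton_iff.2 (eq_of_specializes_of_ne_top hx (specializes_iff_mem_closure.2 hy))

/-- **From spread data over a good open to the spread of supports, strong form** (the closure
argument of `exists_spread_supports_of_verdier`, isolated from the source of the spread data so
that it can be fed by any generic-triviality input). Let `T` be a smooth irreducible curve over `ℂ`,
`W` quasi-projective, `f : W ⟶ T` proper with smooth projective `d`-dimensional fibres over the
complex points off `S`, `c ∈ H^{2q}(W(ℂ); ℂ)`, and suppose given SPREAD DATA: a non-empty open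
`U ⊆ T ∖ S` and a Zariski-closed `Zc ⊆ W` whose slices over the complex points of `U` have dimension
`≤ d - q` pointwise and carry `c|_{W_t}` (the output of `exists_spread_data_of_verdier`). Then
`𝒵 := closure (Zc ∩ f⁻¹U)` and `S' := T ∖ U` satisfy the conclusion of the strong form: dying-off over
`U` is inherited (slices only grow), EVERY slice of `𝒵` has dimension `≤ d - q` pointwise and `𝒵`
itself has `height z + q ≤ d + 1` ("the limit of a family of `(d-q)`-dimensional supports over a
curve is `(d-q)`-dimensional", Fulton §10.1; the curve argument of the module docstring, run inside
`P × T ⊇ W` for a projective `P ⊇ W`: the closure of a generic point over the generic point of `T` is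
flat over the smooth curve, Hartshorne III.9.7, with fibres of constant dimension attained inside a
good slice). [cite: VoisinHodgeII2003, §3.3.1 and §10.2.1 (proof of Thm. 10.19)]
[cite: CharlesSchnell2014Notes, Prop. 11.3.11 (proof)] [cite: Fulton1998, §10.1]
[cite: Hartshorne1977, III Prop. 9.7] -/
theorem exists_spread_supports_of_spread_data
    {d q : ℕ} {T W : Motives.SchemeOver ℂ} (f : W ⟶ T) [SmoothOfRelativeDimension 1 T.hom]
    [IrreducibleSpace T.left] (hW : IsQuasiProjectiveOver W) [IsProper f.left]
    {S : Set T.left}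
    (hfib : ∀ t : Motives.ComplexPoints T, t.pt ∉ S →
      Motives.IsSmoothProjective d (Motives.fiberOver f t))
    (c : complexBetti W (2 * q))
    {U : T.left.Opens} (hUne : (U : Set T.left).Nonempty) (hUS : (U : Set T.left) ⊆ Sᶜ)
    {Zc : Set W.left} (hZcc : IsClosed Zc)
    (hZc : ∀ t : Motives.ComplexPoints T, t.pt ∈ U →
      (∀ m : (Motives.fiberOver f t).left, (Motives.fiberι f t).left.base m ∈ Zc →
        height m + q ≤ (d : ℕ∞)) ∧
      complexBetti.restrictCompl (Motives.fiberOver f t) ((Motives.fiberι f t).left.base ⁻¹' Zc)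
        (2 * q) (complexBetti.map (Motives.fiberι f t) (2 * q) c) = 0) :
    ∃ 𝒵 : Set W.left, IsClosed 𝒵 ∧
      (∀ (t : Motives.ComplexPoints T) (m : (Motives.fiberOver f t).left),
        (Motives.fiberι f t).left.base m ∈ 𝒵 → height m + q ≤ (d : ℕ∞)) ∧
      (∀ z ∈ 𝒵, height z + q ≤ ((d + 1 : ℕ) : ℕ∞)) ∧
      ∃ S' : Set T.left, IsClosed S' ∧ S ⊆ S' ∧ S' ≠ Set.univ ∧
        ∀ t : Motives.ComplexPoints T, t.pt ∉ S' →
          complexBetti.restrictCompl (Motives.fiberOver f t) ((Motives.fiberι f t).left.base ⁻¹' 𝒵)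
            (2 * q) (complexBetti.map (Motives.fiberι f t) (2 * q) c) = 0 := by
  -- the standing instances
  haveI : Smooth T.hom := SmoothOfRelativeDimension.smooth 1 T.hom
  haveI : IsReduced T.left := isReduced_of_smooth_over_field T.hom
  haveI : IsIntegral T.left := isIntegral_of_irreducibleSpace_of_isReduced T.left
  haveI : LocallyOfFiniteType T.hom := inferInstance
  haveI : LocallyOfFiniteType W.hom := locallyOfFiniteType_of_isQuasiProjectiveOver hW
  set Z₀ : Set W.left := Zc ∩ f.left.base ⁻¹' (U : Set T.left) with hZ₀
  set 𝒵 : Set W.left := closure Z₀ with h𝒵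
  have h𝒵Zc : 𝒵 ⊆ Zc := closure_minimal Set.inter_subset_left hZcc
  -- (1) `W` is a Noetherian space; `𝒵` is the finite union of the closures of points `ζ ∈ Z₀`
  obtain ⟨P, jW, hP, hjW⟩ := hW
  haveI := hjW
  haveI : IsProper P.hom := hP.isProper
  haveI : LocallyOfFiniteType P.hom := inferInstance
  haveI : NoetherianSpace W.left := by
    haveI : IsLocallyNoetherian P.left := LocallyOfFiniteType.isLocallyNoetherian P.hom
    haveI : CompactSpace P.left := QuasiCompact.compactSpace_of_compactSpace P.hom
    haveI : IsNoetherian P.left := {}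
    exact jW.left.isOpenEmbedding.isInducing.noetherianSpace
  obtain ⟨F, hFfin, -, hFirr, hFcov⟩ :=
    TopologicalSpace.NoetherianSpace.exists_finite_set_isClosed_irreducible
      (isClosed_univ : IsClosed (Set.univ : Set ↥Z₀))
  have hgen : ∀ C ∈ F, ∃ ζ ∈ Z₀, Subtype.val '' C ⊆ closure {ζ} := by
    intro C hC
    have hirr : IsIrreducible (Subtype.val '' C : Set W.left) :=
      (hFirr C hC).image _ continuous_subtype_val.continuousOn
    have hζ : IsGenericPoint hirr.genericPoint (closure (Subtype.val '' C)) :=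
      hirr.isGenericPoint_genericPoint_closure
    have hCZ₀ : (Subtype.val '' C : Set W.left) ⊆ Z₀ := by
      rintro _ ⟨z, -, rfl⟩
      exact z.2
    refine ⟨hirr.genericPoint, ⟨?_, ?_⟩, ?_⟩
    · exact closure_minimal (hCZ₀.trans Set.inter_subset_left) hZcc hζ.mem
    · obtain ⟨z, hz⟩ := (hFirr C hC).nonempty
      have hmem : (z : W.left) ∈ f.left.base ⁻¹' (U : Set T.left) := z.2.2
      exact (hζ.mem_open_set_iff (U.2.preimage f.left.continuous)).2
        ⟨z, subset_closure ⟨z, hz, rfl⟩, hmem⟩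
    · rw [hζ.def]
      exact subset_closure
  -- `W` is non-empty (a good fibre is a smooth projective variety), so we may choose the points
  haveI : Nonempty W.left := by
    obtain ⟨t₀, ht₀⟩ := exists_complexPoint_pt_mem_inter (H := T) U.2 isClosed_univ
      ⟨_, hUne.some_mem, Set.mem_univ _⟩
    haveI := (hfib t₀ (fun h => hUS ht₀.1 h)).irreducibleSpace
    exact ⟨(Motives.fiberι f t₀).left.base (Classical.arbitrary _)⟩
  choose! ζ hζZ₀ hζC using hgen
  have hζ𝒵 : ∀ C ∈ F, closure {ζ C} ⊆ 𝒵 := fun C hC =>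
    closure_minimal (Set.singleton_subset_iff.2 (subset_closure (hζZ₀ C hC))) isClosed_closure
  have h𝒵cov : 𝒵 ⊆ ⋃ C ∈ F, closure {ζ C} := by
    refine closure_minimal (fun w hw => ?_) (hFfin.isClosed_biUnion fun C _ => isClosed_closure)
    have hw' : (⟨w, hw⟩ : ↥Z₀) ∈ (Set.univ : Set ↥Z₀) := Set.mem_univ _
    rw [hFcov] at hw'
    obtain ⟨C, hC, hwC⟩ := Set.mem_sUnion.1 hw'
    exact Set.mem_iUnion₂.2 ⟨C, hC, hζC C hC ⟨_, hwC, rfl⟩⟩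
  -- (2) the good slice bound at a point of `Zc` over a complex point of `U`
  have hgoodpt : ∀ (t : Motives.ComplexPoints T) (w : W.left), t.pt ∈ U → w ∈ Zc →
      f.left.base w = t.pt → height w + q ≤ (d : ℕ∞) := by
    intro t w ht hw hwt
    obtain ⟨m'', hm''⟩ := exists_fiberι_base_eq f t w hwt
    have hb := (hZc t ht).1 m'' (by rw [hm'']; exact hw)
    rwa [← hm'', height_fiberι_base_eq]
  -- (3) the curve argument inside `P × T` for the `ζ` over the generic point of `T`
  obtain ⟨heprop, heheight⟩ := isProper_lift_and_height_eq jW f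
  set e : W ⟶ P ⊗ T := CartesianMonoidalCategory.lift jW f with he
  haveI : IsProper e.left := heprop
  have hesnd : ∀ w, (CartesianMonoidalCategory.snd P T).left.base (e.left.base w) = f.left.base w :=
    fun w => by
    have h1 := congrArg (fun φ => φ.left.base w) (CartesianMonoidalCategory.lift_snd jW f)
    simpa only [Over.comp_left, Scheme.Hom.comp_base, TopCat.coe_comp, Function.comp_apply] using h1
  have hefst : ∀ w, (CartesianMonoidalCategory.fst P T).left.base (e.left.base w) = jW.left.base w :=
    fun w => by
    have h1 := congrArg (fun φ => φ.left.base w) (CartesianMonoidalCategory.lift_fst jW f)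
    simpa only [Over.comp_left, Scheme.Hom.comp_base, TopCat.coe_comp, Function.comp_apply] using h1
  haveI : LocallyOfFiniteType (CartesianMonoidalCategory.snd P T).left :=
    inferInstanceAs (LocallyOfFiniteType (pullback.snd P.hom T.hom))
  have hα : ∀ ζ' : W.left, ζ' ∈ Z₀ → f.left.base ζ' = ⊤ →
      height ζ' + q ≤ ((d + 1 : ℕ) : ℕ∞) ∧
      ∀ (t : Motives.ComplexPoints T) (x : W.left), x ∈ closure {ζ'} → f.left.base x = t.pt →
        height x + q ≤ (d : ℕ∞) := by
    intro ζ' hζ'Z₀ hw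
    have hζ'𝒵 : closure {ζ'} ⊆ 𝒵 :=
      closure_minimal (Set.singleton_subset_iff.2 (subset_closure hζ'Z₀)) isClosed_closure
    -- the integral closed subscheme `Wc = closure {e ζ'}` of `P × T`; it dominates `T`
    set Wc : ClosedSubscheme (P ⊗ T).left :=
      (ClosedSubvariety.ofPoint (P ⊗ T).left (e.left.base ζ')).toClosedSubscheme with hWc
    have hWrange : Set.range Wc.ι.base = closure {e.left.base ζ'} :=
      ClosedSubvariety.range_ofPoint_ι (X := (P ⊗ T).left) (e.left.base ζ')
    obtain ⟨b, hb⟩ : e.left.base ζ' ∈ Set.range Wc.ι.base := by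
      rw [hWrange]; exact subset_closure (Set.mem_singleton _)
    have hsnd_b : (Wc.ι ≫ (CartesianMonoidalCategory.snd P T).left).base b = ⊤ := by
      simp only [Scheme.Hom.comp_base, TopCat.coe_comp, Function.comp_apply]
      rw [hb, hesnd, hw]
    haveI : IsDominant (Wc.ι ≫ (CartesianMonoidalCategory.snd P T).left) := by
      refine ⟨dense_iff_closure_eq.2 (Set.eq_univ_of_univ_subset ?_)⟩
      have h1 : closure {(⊤ : T.left)} ⊆
          closure (Set.range (Wc.ι ≫ (CartesianMonoidalCategory.snd P T).left).base) :=
        closure_mono (Set.singleton_subset_iff.2 ⟨b, hsnd_b⟩)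
      rwa [show closure {(⊤ : T.left)} = Set.univ from (genericPoint_spec T.left).def] at h1
    haveI : Flat (Wc.ι ≫ (CartesianMonoidalCategory.snd P T).left) :=
      flat_of_isDominant_of_smoothCurve T _
    -- a complex point `u` of `U` in the image, a maximal point `w₀` of `Wc_u`, inside a good slice
    obtain ⟨u, huU, b', hb'⟩ := exists_complexPoint_pt_mem_inter_range
      (Wc.ι ≫ (CartesianMonoidalCategory.snd P T).left) U hUne
    obtain ⟨wu, -⟩ := exists_fst_familyFiber_eq Wc u b' hb'
    obtain ⟨w₀, hw₀, -⟩ := exists_isMax_specializes wu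
    have h3 : height ((familyFiber Wc u).ι.base w₀) = height w₀ :=
      height_base_eq_of_isClosedImmersion' _ w₀
    have hr : (sliceAt P u).left.base ((familyFiber Wc u).ι.base w₀) ∈ Set.range Wc.ι.base := by
      have h : (familyFiber Wc u).ι.base w₀ ∈ Set.range (familyFiber Wc u).ι.base := ⟨w₀, rfl⟩
      rwa [range_familyFiber_ι] at h
    rw [hWrange, ← Set.image_singleton,
      e.left.isClosedMap.closure_image_eq_of_continuous e.left.continuous] at hr
    obtain ⟨w₁, hw₁ζ, hw₁⟩ := hr
    have hw₁u : f.left.base w₁ = u.pt := by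
      rw [← hesnd, hw₁]
      exact snd_sliceAt_base u _
    have hb₁ : height w₁ + q ≤ (d : ℕ∞) := hgoodpt u w₁ huU (h𝒵Zc (hζ'𝒵 hw₁ζ)) hw₁u
    have hw₀w₁ : height w₀ = height w₁ := by
      calc height w₀ = height ((familyFiber Wc u).ι.base w₀) := h3.symm
        _ = height ((sliceAt P u).left.base ((familyFiber Wc u).ι.base w₀)) :=
            (height_sliceAt_base_eq u _).symm
        _ = height (e.left.base w₁) := by rw [hw₁]
        _ = height w₁ := heheight w₁
    refine ⟨?_, fun t x hx hxt => ?_⟩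
    · -- `height ζ' = dim Wc = height w₀ + 1`
      have h4 := height_familyFiber_add_one_eq_of_isMax Wc u w₀ hw₀
      have h5 : height (⊤ : Wc.carrier) = height ζ' := by
        rw [← height_base_eq_of_isClosedImmersion' Wc.ι ⊤]
        change height (ClosedSubvariety.ofPoint (P ⊗ T).left (e.left.base ζ')).genericPoint = _
        rw [ClosedSubvariety.genericPoint_ofPoint]
        exact heheight ζ'
      rw [← h5, ← h4, hw₀w₁, add_assoc, add_comm (1 : ℕ∞), ← add_assoc, Nat.cast_add, Nat.cast_one]
      exact add_le_add hb₁ le_rfl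
    · -- a fibre point `x ∈ closure {ζ'}` over `t`: `jW x ∈ Wc_t`, of height `≤ height w₀`
      have hex : e.left.base x ∈ closure {e.left.base ζ'} :=
        ((specializes_iff_mem_closure.2 hx).map e.left.continuous).mem_closure
      obtain ⟨a, ha⟩ : e.left.base x ∈ Set.range Wc.ι.base := by rw [hWrange]; exact hex
      have hslice_x : (sliceAt P t).left.base (jW.left.base x) = e.left.base x := by
        obtain ⟨x', hx'⟩ := exists_sliceAt_base_eq (𝒳 := P) t (e.left.base x) (by rw [hesnd, hxt])
        have hxx : x' = jW.left.base x := by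
          have h1 := congrArg (fun φ => φ.left.base x') (sliceAt_fst P t)
          simp only [Over.comp_left, Scheme.Hom.comp_base, TopCat.coe_comp, Function.comp_apply,
            Over.id_left, Scheme.Hom.id_base, TopCat.coe_id, id_eq] at h1
          rw [← h1, hx', hefst]
        rw [← hxx, hx']
      obtain ⟨a₁, ha₁⟩ : jW.left.base x ∈ Set.range (familyFiber Wc t).ι.base := by
        rw [range_familyFiber_ι]
        exact ⟨a, ha.trans hslice_x.symm⟩
      have h1 : height (jW.left.base x) = height a₁ := by
        rw [← ha₁]
        exact height_base_eq_of_isClosedImmersion' _ a₁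
      have h2 : height a₁ ≤ height w₀ := height_familyFiber_le_of_isMax Wc hw₀ t a₁
      have h4 : height x ≤ height w₁ := by
        calc height x = height (jW.left.base x) :=
              (height_base_eq_of_isOpenImmersion_of_schemeOver jW x).symm
          _ = height a₁ := h1
          _ ≤ height w₀ := h2
          _ = height w₁ := hw₀w₁
      exact (add_le_add h4 le_rfl).trans hb₁
  -- (4) the case of a `ζ` over a closed point: the closure lies in the good fibre
  have hβ : ∀ ζ' : W.left, ζ' ∈ Z₀ → f.left.base ζ' ≠ ⊤ →
      ∀ x : W.left, x ∈ closure {ζ'} → height x + q ≤ (d : ℕ∞) := by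
    intro ζ' hζ'Z₀ hw x hx
    have hζx : ζ' ⤳ x := specializes_iff_mem_closure.2 hx
    obtain ⟨t, ht⟩ := exists_complexPoint_pt_mem_inter (H := T) U.2
      (isClosed_singleton_of_ne_top_of_smoothCurve hw) ⟨f.left.base ζ', hζ'Z₀.2, Set.mem_singleton _⟩
    have hζt : f.left.base ζ' = t.pt := (Set.mem_singleton_iff.1 ht.2).symm
    have hb := hgoodpt t ζ' (hζt ▸ hζ'Z₀.2) hζ'Z₀.1 hζt
    have hle : height x ≤ height ζ' := height_mono (Scheme.le_iff_specializes.2 hζx)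
    exact (add_le_add hle le_rfl).trans hb
  -- assemble
  refine ⟨𝒵, isClosed_closure, fun t m hm => ?_, fun z hz => ?_, (U : Set T.left)ᶜ,
    U.2.isClosed_compl, Set.subset_compl_comm.1 hUS, ?_, fun t ht => ?_⟩
  · -- fibrewise bound
    obtain ⟨C, hC, hxC⟩ := Set.mem_iUnion₂.1 (h𝒵cov hm)
    have hmx : height m = height ((Motives.fiberι f t).left.base m) :=
      (height_fiberι_base_eq f t m).symm
    rw [hmx]
    by_cases hw : f.left.base (ζ C) = ⊤
    · exact (hα (ζ C) (hζZ₀ C hC) hw).2 t _ hxC (apply_fiberι_base_eq_pt f t m)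
    · exact hβ (ζ C) (hζZ₀ C hC) hw _ hxC
  · -- total bound
    obtain ⟨C, hC, hzC⟩ := Set.mem_iUnion₂.1 (h𝒵cov hz)
    by_cases hw : f.left.base (ζ C) = ⊤
    · have hle : height z ≤ height (ζ C) :=
        height_mono (Scheme.le_iff_specializes.2 (specializes_iff_mem_closure.2 hzC))
      exact (add_le_add hle le_rfl).trans (hα (ζ C) (hζZ₀ C hC) hw).1
    · have h := hβ (ζ C) (hζZ₀ C hC) hw z hzC
      exact h.trans (by exact_mod_cast Nat.le_succ d)
  · -- `S' = T ∖ U ≠ T`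
    intro h
    obtain ⟨x, hx⟩ := hUne
    exact (h ▸ Set.mem_univ x : x ∈ (U : Set T.left)ᶜ) hx
  · -- dying off `ι_t⁻¹ 𝒵 ⊇ ι_t⁻¹ Zc` over `U`
    have ht' : t.pt ∈ (U : Set T.left) := by
      by_contra h
      exact ht h
    refine complexBetti.restrictCompl_eq_zero_of_subset (fun m hm => ?_) (hZc t ht').2
    exact subset_closure ⟨hm, by
      change f.left.base ((Motives.fiberι f t).left.base m) ∈ (U : Set T.left)
      rw [apply_fiberι_base_eq_pt]; exact ht'⟩

/-- **Spreading fibrewise algebraic supports over a smooth curve, strong form** (granted Verdier's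
generic local triviality `Motives.Verdier1976_genericLocalTriviality`). As the named fact
`spread_supports_over_smoothCurve` (see `spread_supports_over_smoothCurve_of_verdier` below and the
module docstring for the proof), but WITHOUT the flatness hypothesis on `f` and WITH the additional
total-space dimension bound `height z + q ≤ d + 1` for every point `z` of the spread `𝒵` (the
horizontal components of `𝒵` have dimension `≤ d - q + 1`: the closure of a generic point over the
generic point of `T` is flat over the smooth curve with `(d - q)`-dimensional fibres, Fulton §10.1;
Hartshorne III.9.7). The spread data come from `exists_spread_data_of_verdier`, the closure argument
is `exists_spread_supports_of_spread_data`. [cite: VoisinHodgeII2003, §3.3.1 and §10.2.1 (proof of Thm. 10.19)]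
[cite: CharlesSchnell2014Notes, Prop. 11.3.11 (proof)] [cite: Fulton1998, §10.1]
[cite: Verdier1976, Thm. (3.3), Thm. (4.14), Cor. (5.1)] -/
theorem exists_spread_supports_of_verdier (hGT : Verdier1976_genericLocalTriviality)
    {d q : ℕ} {T W : Motives.SchemeOver ℂ} (f : W ⟶ T) [SmoothOfRelativeDimension 1 T.hom]
    [IrreducibleSpace T.left] (hW : IsQuasiProjectiveOver W) [IsProper f.left]
    {S : Set T.left} (hS : IsClosed S) (hSne : S ≠ Set.univ)
    (hfib : ∀ t : Motives.ComplexPoints T, t.pt ∉ S →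
      Motives.IsSmoothProjective d (Motives.fiberOver f t))
    (c : complexBetti W (2 * q))
    (halg : ∀ t : Motives.ComplexPoints T, t.pt ∉ S →
      complexBetti.map (Motives.fiberι f t) (2 * q) c ∈ algebraicClasses (Motives.fiberOver f t) q) :
    ∃ 𝒵 : Set W.left, IsClosed 𝒵 ∧
      (∀ (t : Motives.ComplexPoints T) (m : (Motives.fiberOver f t).left),
        (Motives.fiberι f t).left.base m ∈ 𝒵 → height m + q ≤ (d : ℕ∞)) ∧
      (∀ z ∈ 𝒵, height z + q ≤ ((d + 1 : ℕ) : ℕ∞)) ∧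
      ∃ S' : Set T.left, IsClosed S' ∧ S ⊆ S' ∧ S' ≠ Set.univ ∧
        ∀ t : Motives.ComplexPoints T, t.pt ∉ S' →
          complexBetti.restrictCompl (Motives.fiberOver f t) ((Motives.fiberι f t).left.base ⁻¹' 𝒵)
            (2 * q) (complexBetti.map (Motives.fiberι f t) (2 * q) c) = 0 := by
  -- the standing instances
  haveI : Smooth T.hom := SmoothOfRelativeDimension.smooth 1 T.hom
  haveI : IsReduced T.left := isReduced_of_smooth_over_field T.hom
  haveI : IsIntegral T.left := isIntegral_of_irreducibleSpace_of_isReduced T.left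
  -- the spread data over a good open `U`, then the closure argument
  obtain ⟨U, hUne, hUS, Zc, hZcc, hZc⟩ := exists_spread_data_of_verdier hGT f hW hS hSne hfib c halg
  exact exists_spread_supports_of_spread_data f hW hfib c hUne hUS hZcc hZc

/-- **The named fact `spread_supports_over_smoothCurve` holds, granted Verdier's generic local
triviality of pairs** (`Motives.Verdier1976_genericLocalTriviality`): the weakening of
`exists_spread_supports_of_verdier` that forgets the total-space bound (and does not use the
flatness hypothesis). [cite: VoisinHodgeII2003, §3.3.1 and §10.2.1 (proof of Thm. 10.19)]
[cite: CharlesSchnell2014Notes, Prop. 11.3.11 (proof)] [cite: Fulton1998, §10.1]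
[cite: Verdier1976, Thm. (3.3), Thm. (4.14), Cor. (5.1)] -/
theorem spread_supports_over_smoothCurve_of_verdier (hGT : Verdier1976_genericLocalTriviality) :
    spread_supports_over_smoothCurve := by
  intro d q T W f hT1 hTirr hW _hflat hprop _hq1 _hqd S hS hSne hfib c halg
  haveI := hT1
  haveI := hprop
  obtain ⟨𝒵, h𝒵c, hfibre, -, S', hS'c, hSS', hS'ne, hdies⟩ :=
    exists_spread_supports_of_verdier hGT f hW hS hSne hfib c halg
  exact ⟨𝒵, h𝒵c, hfibre, S', hS'c, hSS', hS'ne, hdies⟩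

end Final

section Pencil

/-- **The named fact `spread_supports_over_projectiveLine` holds, granted Verdier's generic local
triviality of pairs** (`Motives.Verdier1976_genericLocalTriviality`): the case `T = ℙ¹`, `W = X`
smooth projective of `exists_spread_supports_of_verdier`, the total-space dimension bound
`height z + q ≤ n` being `q ≤ coheight z` on `X`. [cite: VoisinHodgeII2003, §3.3.1 and §10.2.1 (proof of Thm. 10.19)]
[cite: CharlesSchnell2014Notes, Prop. 11.3.11 (proof)] [cite: Verdier1976, Cor. (5.1)] -/
theorem spread_supports_over_projectiveLine_of_verdier (hGT : Verdier1976_genericLocalTriviality) :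
    spread_supports_over_projectiveLine := by
  intro n q X hX hq1 hqn φ S hS hSne hfib c halg
  have hP : IsSmoothProjective 1 (projectiveSpace 1 ℂ) := isSmoothProjective_projectiveSpace_holds ℂ 1
  haveI := hP.smoothOfRelativeDimension
  haveI : IrreducibleSpace (projectiveSpace 1 ℂ).left := hP.irreducibleSpace
  haveI : IsProper X.hom := IsSmoothProjective.isProper_holds hX
  haveI : IsProper (projectiveSpace 1 ℂ).hom := IsSmoothProjective.isProper_holds hP
  haveI : IsProper φ.left := by
    haveI : IsProper (φ.left ≫ (projectiveSpace 1 ℂ).hom) := by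
      rw [Over.w φ]
      infer_instance
    exact IsProper.of_comp φ.left (projectiveSpace 1 ℂ).hom
  have hW : IsQuasiProjectiveOver X := IsQuasiProjectiveOver.of_isProjectiveOver hX.isProjectiveOver
  obtain ⟨𝒵, h𝒵c, -, htot, S', hS'c, hSS', hS'ne, hdies⟩ :=
    exists_spread_supports_of_verdier hGT (d := n - 1) (q := q) φ hW hS hSne hfib c halg
  refine ⟨𝒵, h𝒵c, fun z hz => ?_, S', hS'c, hSS', hS'ne, hdies⟩
  rw [le_coheight_iff_height_add_le hX z q]
  have h := htot z hz
  have hn : n - 1 + 1 = n := Nat.sub_add_cancel (by omega)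
  rwa [hn] at h

end Pencil

end HodgeTheory

end Literature.AlgebraicGeometry.HodgeTheory

end
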